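import Summits.BirchSwinnertonDyer.BirchSwinnertonDyer.Theorems.ResidualThetaTransportAtTwoHeckeThetaPartnerAdicAtTwoThetaCharacter
import Summits.BirchSwinnertonDyer.BirchSwinnertonDyer.Theorems.ResidualThetaTransportAtTwoHeckeThetaPartnerAdicAtTwoThetaCoset
import Literature.Analysis.SpecialFunctions.RiemannThetaGradient
import HarnessLib

/-!
# Coset theta series of an ideal class: coordinates, `q`-series (toward K0⁺, stmt-20690)

Route `ResidualThetaTransportAtTwo`, crux K0⁺ `HeckeThetaPartnerAdicAtTwo` (stmt-BirchSwinnertonDyer-20690),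
line "Hecke theta series from the genus-two Riemann theta function".  THEOREMS ONLY.

Ideal level of `ThetaCoset`.  `K` imaginary quadratic, `σ : K → ℂ`, `𝔞, 𝔪 ≠ 0` ideals,
`𝔟 = 𝔞𝔪` with Gram data `(b, B)` (`ThetaGram.exists_gram`), `M = N𝔪`, `x₀ ∈ 𝔞` and `k ∈ ℤ²` the
coordinates of `M x₀ ∈ 𝔟` (`exists_coords`).  The **coset theta series**
`Θ(τ; x₀ + 𝔟) = Σ_{x ∈ x₀ + 𝔟} σ(x) q^{N(x)/N𝔞}` is `(2πi)⁻¹ ∇_u ϑ[k/M; 0](0, (Mτ)·B)` with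
`u = (σ b₁, σ b₂)`:

* `dotProduct_coset_eq_embedding` — `ᵗ(m + k/M) u = σ(x₀ + x_m)`;
* `riemannThetaCharTerm_coset_eq_pow` — the general term is `q^{N(x₀ + x_m)/N𝔞}`;
* `dotProduct_mulVec_coords` — `ᵗkBk = 2M · N(x₀)/N𝔞` (so the phase of `ThetaCoset` is trivial);
* `hasSum_fderiv_thetaCoset` — `∇_u ϑ[k/M; 0](0, (Mτ)·B) = Σ_m 2πi σ(x₀ + x_m) q^{N(x₀+x_m)/N𝔞}`;
* `riemannThetaChar_coset_eq_of_sub_mem` — `Θ(τ; x₀ + 𝔟)` depends only on the coset `x₀ + 𝔟`;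
* `fderiv_thetaCoset_apply_moeb` — **the law on `Γ₀(|d_K|·M)`**:
  `Θ(γτ; d·x₀ + 𝔟) = κ(d) (cτ+d)² Θ(τ; x₀ + 𝔟)` with `κ` the Kronecker character
  (`ThetaCoset.fderiv_thetaCoset_smul` + `ThetaCharacter.binaryTheta_unit_eq_kronecker`; the phase
  `e(πi b d ᵗkBk/M) = e(2πi b d N(x₀)/N𝔞) = 1`).

BSD is not proved by this file.
-/

set_option autoImplicit false
set_option linter.dupNamespace false

noncomputable section

open scoped NumberField ComplexConjugate Real MatrixGroups UpperHalfPlane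
open NumberField Module Matrix Complex Filter

namespace Summit.BirchSwinnertonDyer.BirchSwinnertonDyer.Theorems.HeckeTheta

open Literature.Analysis.SpecialFunctions
open Literature.NumberTheory.ModularForms.BinaryTheta
open Literature.NumberTheory.Automorphic (siegelUpperHalfSpace mem_siegelUpperHalfSpace_iff)

variable {K : Type} [Field K] [NumberField K]

/-! ### Coordinates -/

/-- `σ(Σ vᵢ bᵢ) = Σ vᵢ σ(bᵢ)`. -/
theorem embedding_equivFun_symm (σ : K →+* ℂ) {𝔟 : Ideal (𝓞 K)} (b : Basis (Fin 2) ℤ 𝔟)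
    (v : Fin 2 → ℤ) :
    σ (((b.equivFun.symm v : 𝔟) : 𝓞 K) : K) = ∑ i, (v i : ℂ) * σ ((b i : 𝓞 K) : K) := by
  have hxsum : (((b.equivFun.symm v : 𝔟) : 𝓞 K) : K) = ∑ i, (v i : K) * ((b i : 𝓞 K) : K) := by
    rw [Basis.equivFun_symm_apply]
    push_cast
    simp [zsmul_eq_mul]
  rw [hxsum, map_sum]
  simp

omit [NumberField K] in
/-- `x_{Mm + k} = M x_m + x_k` in `𝓞 K`. -/
theorem coe_equivFun_symm_natCast_mul_add {𝔟 : Ideal (𝓞 K)} (b : Basis (Fin 2) ℤ 𝔟) (M : ℕ)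
    (m k : Fin 2 → ℤ) :
    ((b.equivFun.symm (fun i => (M : ℤ) * m i + k i) : 𝔟) : 𝓞 K) =
      (M : 𝓞 K) * ((b.equivFun.symm m : 𝔟) : 𝓞 K) + ((b.equivFun.symm k : 𝔟) : 𝓞 K) := by
  have h : (fun i => (M : ℤ) * m i + k i) = (M : ℤ) • m + k := by
    funext i; simp
  rw [h, map_add, LinearEquiv.map_smul, Submodule.coe_add, Submodule.coe_smul_of_tower, zsmul_eq_mul]
  push_cast
  ring

/-- **Coordinates of `M x₀`**: for `x₀ ∈ 𝔞` and `𝔟 = 𝔞𝔪`, `M x₀ ∈ 𝔟` (`M = N𝔪 ∈ 𝔪`), so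
`M x₀ = Σ kᵢ bᵢ` for some `k ∈ ℤ²`. -/
theorem exists_coords {𝔞 𝔪 𝔟 : Ideal (𝓞 K)} (h𝔟 : 𝔟 = 𝔞 * 𝔪) (b : Basis (Fin 2) ℤ 𝔟)
    {x₀ : 𝓞 K} (hx₀ : x₀ ∈ 𝔞) :
    ∃ k : Fin 2 → ℤ, ((b.equivFun.symm k : 𝔟) : 𝓞 K) = (Ideal.absNorm 𝔪 : 𝓞 K) * x₀ := by
  have hmem : (Ideal.absNorm 𝔪 : 𝓞 K) * x₀ ∈ 𝔟 := by
    rw [h𝔟, mul_comm]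
    exact Ideal.mul_mem_mul (Ideal.absNorm_mem 𝔪) hx₀
  refine ⟨b.equivFun ⟨_, hmem⟩, ?_⟩
  rw [LinearEquiv.symm_apply_apply]

/-- `N((M x)) = M² N((x))` in a quadratic field. -/
theorem absNorm_span_natCast_mul (hK : finrank ℚ K = 2) (M : ℕ) (x : 𝓞 K) :
    Ideal.absNorm (Ideal.span {(M : 𝓞 K) * x}) = M ^ 2 * Ideal.absNorm (Ideal.span {x}) := by
  rw [← Ideal.span_singleton_mul_span_singleton, map_mul, Ideal.absNorm_span_singleton,
    show (M : 𝓞 K) = algebraMap ℤ (𝓞 K) (M : ℤ) by simp, Algebra.norm_algebraMap,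
    RingOfIntegers.rank, hK]
  simp [Int.natAbs_pow]

/-- For `x ∈ 𝔞`: `N𝔞 ∣ N((x))`, and `N((Mx))/N(𝔞𝔪) = M · N((x))/N𝔞` (`M = N𝔪`). -/
theorem absNorm_span_mul_div (hK : finrank ℚ K = 2) {𝔞 𝔪 𝔟 : Ideal (𝓞 K)} (h𝔟 : 𝔟 = 𝔞 * 𝔪)
    (h𝔞 : 𝔞 ≠ ⊥) (h𝔪 : 𝔪 ≠ ⊥) {x : 𝓞 K} (hx : x ∈ 𝔞) :
    Ideal.absNorm 𝔞 ∣ Ideal.absNorm (Ideal.span {x}) ∧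
      Ideal.absNorm (Ideal.span {(Ideal.absNorm 𝔪 : 𝓞 K) * x}) / Ideal.absNorm 𝔟 =
        Ideal.absNorm 𝔪 * (Ideal.absNorm (Ideal.span {x}) / Ideal.absNorm 𝔞) := by
  have hdvd : Ideal.absNorm 𝔞 ∣ Ideal.absNorm (Ideal.span {x}) :=
    Ideal.absNorm_dvd_absNorm_of_le ((Ideal.span_singleton_le_iff_mem _).mpr hx)
  refine ⟨hdvd, ?_⟩
  obtain ⟨n, hn⟩ := hdvd
  have hA : Ideal.absNorm 𝔞 ≠ 0 := by rw [Ne, Ideal.absNorm_eq_zero_iff]; exact h𝔞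
  have hM : Ideal.absNorm 𝔪 ≠ 0 := by rw [Ne, Ideal.absNorm_eq_zero_iff]; exact h𝔪
  rw [absNorm_span_natCast_mul hK, hn, h𝔟, map_mul, Nat.mul_div_cancel_left _ (Nat.pos_of_ne_zero hA),
    show Ideal.absNorm 𝔪 ^ 2 * (Ideal.absNorm 𝔞 * n) = (Ideal.absNorm 𝔞 * Ideal.absNorm 𝔪) * (Ideal.absNorm 𝔪 * n) by ring,
    Nat.mul_div_cancel_left _ (Nat.pos_of_ne_zero (mul_ne_zero hA hM))]

/-! ### The coset theta series: linear form, general term, `q`-series -/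

/-- **`ᵗ(m + k/M) u = σ(x₀ + x_m)`** for `u = (σ bᵢ)ᵢ` and `Σ kᵢbᵢ = M x₀`. -/
theorem dotProduct_coset_eq_embedding (σ : K →+* ℂ) {𝔟 : Ideal (𝓞 K)} (b : Basis (Fin 2) ℤ 𝔟)
    {M : ℕ} (hM : M ≠ 0) {x₀ : 𝓞 K} {k : Fin 2 → ℤ}
    (hk : ((b.equivFun.symm k : 𝔟) : 𝓞 K) = (M : 𝓞 K) * x₀) (m : Fin 2 → ℤ) :
    (((fun i => (m i : ℂ)) + fun i => (k i : ℂ) / M) ⬝ᵥ fun i => σ ((b i : 𝓞 K) : K)) =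
      σ ((x₀ : K) + (((b.equivFun.symm m : 𝔟) : 𝓞 K) : K)) := by
  have hM' : (M : ℂ) ≠ 0 := by exact_mod_cast hM
  have h1 := embedding_equivFun_symm σ b m
  have h2 := embedding_equivFun_symm σ b k
  rw [hk] at h2
  push_cast at h2
  rw [map_mul, map_natCast] at h2
  rw [map_add, h1]
  simp only [dotProduct, Pi.add_apply, Fin.sum_univ_two] at h2 ⊢
  field_simp
  linear_combination (-1) * h2

/-- **The general term of the coset theta**: for `x₀ ∈ 𝔞`, `Σ kᵢbᵢ = M x₀`, `m ∈ ℤ²` and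
`x = x₀ + x_m`: `e(πi ᵗ(m + k/M) (Mτ B) (m + k/M)) = q^{N((x))/N𝔞}`, `q = e(τ)`
(`ᵗ(Mm+k) B (Mm+k) · N𝔟 = 2N((Mx)) = 2M² N((x))`, `N𝔟 = M N𝔞`). -/
theorem riemannThetaCharTerm_coset_eq_pow (hK : finrank ℚ K = 2) [IsTotallyComplex K] (σ : K →+* ℂ)
    {𝔞 𝔪 𝔟 : Ideal (𝓞 K)} (h𝔟 : 𝔟 = 𝔞 * 𝔪) (h𝔞 : 𝔞 ≠ ⊥) (h𝔪 : 𝔪 ≠ ⊥) (b : Basis (Fin 2) ℤ 𝔟)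
    {B : Matrix (Fin 2) (Fin 2) ℤ}
    (hB : ∀ i j, ((B i j : ℤ) : ℂ) * ((Ideal.absNorm 𝔟 : ℕ) : ℂ) =
      σ ((b i : 𝓞 K) : K) * conj (σ ((b j : 𝓞 K) : K)) + conj (σ ((b i : 𝓞 K) : K)) * σ ((b j : 𝓞 K) : K))
    {x₀ : 𝓞 K} (hx₀ : x₀ ∈ 𝔞) {k : Fin 2 → ℤ}
    (hk : ((b.equivFun.symm k : 𝔟) : 𝓞 K) = (Ideal.absNorm 𝔪 : 𝓞 K) * x₀) (τ : ℂ) (m : Fin 2 → ℤ) :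
    riemannThetaCharTerm (fun i => (k i : ℂ) / (Ideal.absNorm 𝔪 : ℕ)) 0
        ((((Ideal.absNorm 𝔪 : ℕ) : ℂ) * τ) • B.map ((↑) : ℤ → ℂ)) 0 m =
      cexp (2 * π * I * τ) ^
        (Ideal.absNorm (Ideal.span {x₀ + ((b.equivFun.symm m : 𝔟) : 𝓞 K)}) / Ideal.absNorm 𝔞) := by
  set M : ℕ := Ideal.absNorm 𝔪 with hMdef
  have hM : M ≠ 0 := by rw [hMdef, Ne, Ideal.absNorm_eq_zero_iff]; exact h𝔪
  have hM' : (M : ℂ) ≠ 0 := by exact_mod_cast hM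
  have h𝔟0 : 𝔟 ≠ ⊥ := by rw [h𝔟]; exact mul_ne_zero h𝔞 h𝔪
  set x : 𝓞 K := x₀ + ((b.equivFun.symm m : 𝔟) : 𝓞 K) with hxdef
  have hx : x ∈ 𝔞 := by
    refine 𝔞.add_mem hx₀ ?_
    have : ((b.equivFun.symm m : 𝔟) : 𝓞 K) ∈ 𝔟 := (b.equivFun.symm m).2
    exact Ideal.mul_le_right (h𝔟.le this)
  -- the integer vector `v = Mm + k` with `x_v = M x`
  set v : Fin 2 → ℤ := fun i => (M : ℤ) * m i + k i with hvdef
  have hv : ((b.equivFun.symm v : 𝔟) : 𝓞 K) = (M : 𝓞 K) * x := by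
    rw [hvdef, coe_equivFun_symm_natCast_mul_add, hk, hxdef]; ring
  have hquad := dotProduct_mulVec_eq_two_mul_div hK σ h𝔟0 b hB v
  rw [hv, (absNorm_span_mul_div hK h𝔟 h𝔞 h𝔪 hx).2] at hquad
  set n : ℕ := Ideal.absNorm (Ideal.span {x}) / Ideal.absNorm 𝔞 with hndef
  -- the characteristic vector is `v/M`
  have hvec : ((fun i => (m i : ℂ)) + fun i => (k i : ℂ) / (M : ℕ)) = fun i => (M : ℂ)⁻¹ * (v i : ℂ) := by
    funext i
    simp only [Pi.add_apply, hvdef]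
    push_cast
    field_simp
  rw [riemannThetaCharTerm, ← Complex.exp_nat_mul, hvec]
  congr 1
  simp only [add_zero, dotProduct_zero, mul_zero]
  have hq : ((fun i => (M : ℂ)⁻¹ * (v i : ℂ)) ⬝ᵥ
      (((((M : ℕ) : ℂ) * τ) • B.map ((↑) : ℤ → ℂ)) *ᵥ fun i => (M : ℂ)⁻¹ * (v i : ℂ))) =
      (M : ℂ)⁻¹ * τ * ((v ⬝ᵥ (B *ᵥ v) : ℤ) : ℂ) := by
    simp only [dotProduct, Matrix.mulVec, Fin.sum_univ_two, Matrix.smul_apply, Matrix.map_apply,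
      smul_eq_mul]
    push_cast
    field_simp
  rw [hq, hquad]
  push_cast
  field_simp
  ring

/-- **`ᵗkBk = 2M · N((x₀))/N𝔞`** for the coordinates `k` of `M x₀`, `x₀ ∈ 𝔞`. -/
theorem dotProduct_mulVec_coords (hK : finrank ℚ K = 2) [IsTotallyComplex K] (σ : K →+* ℂ)
    {𝔞 𝔪 𝔟 : Ideal (𝓞 K)} (h𝔟 : 𝔟 = 𝔞 * 𝔪) (h𝔞 : 𝔞 ≠ ⊥) (h𝔪 : 𝔪 ≠ ⊥) (b : Basis (Fin 2) ℤ 𝔟)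
    {B : Matrix (Fin 2) (Fin 2) ℤ}
    (hB : ∀ i j, ((B i j : ℤ) : ℂ) * ((Ideal.absNorm 𝔟 : ℕ) : ℂ) =
      σ ((b i : 𝓞 K) : K) * conj (σ ((b j : 𝓞 K) : K)) + conj (σ ((b i : 𝓞 K) : K)) * σ ((b j : 𝓞 K) : K))
    {x₀ : 𝓞 K} (hx₀ : x₀ ∈ 𝔞) {k : Fin 2 → ℤ}
    (hk : ((b.equivFun.symm k : 𝔟) : 𝓞 K) = (Ideal.absNorm 𝔪 : 𝓞 K) * x₀) :
    k ⬝ᵥ (B *ᵥ k) =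
      2 * (Ideal.absNorm 𝔪 : ℤ) * ((Ideal.absNorm (Ideal.span {x₀}) / Ideal.absNorm 𝔞 : ℕ) : ℤ) := by
  have h𝔟0 : 𝔟 ≠ ⊥ := by rw [h𝔟]; exact mul_ne_zero h𝔞 h𝔪
  have hquad := dotProduct_mulVec_eq_two_mul_div hK σ h𝔟0 b hB k
  rw [hk, (absNorm_span_mul_div hK h𝔟 h𝔞 h𝔪 hx₀).2] at hquad
  rw [hquad]
  push_cast
  ring

/-- **The coset theta as a series**: for `Im τ > 0`,
`∇_u ϑ[k/M; 0](0, (Mτ)·B) = Σ_{m ∈ ℤ²} 2πi σ(x₀ + x_m) q^{N((x₀ + x_m))/N𝔞}`, `u = (σ bᵢ)ᵢ`. -/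
theorem hasSum_fderiv_thetaCoset (hK : finrank ℚ K = 2) [IsTotallyComplex K] (σ : K →+* ℂ)
    {𝔞 𝔪 𝔟 : Ideal (𝓞 K)} (h𝔟 : 𝔟 = 𝔞 * 𝔪) (h𝔞 : 𝔞 ≠ ⊥) (h𝔪 : 𝔪 ≠ ⊥) (b : Basis (Fin 2) ℤ 𝔟)
    {B : Matrix (Fin 2) (Fin 2) ℤ}
    (hB : ∀ i j, ((B i j : ℤ) : ℂ) * ((Ideal.absNorm 𝔟 : ℕ) : ℂ) =
      σ ((b i : 𝓞 K) : K) * conj (σ ((b j : 𝓞 K) : K)) + conj (σ ((b i : 𝓞 K) : K)) * σ ((b j : 𝓞 K) : K))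
    (hsymm : B.IsSymm) (hpos : (B.map (Int.cast : ℤ → ℝ)).PosDef)
    {x₀ : 𝓞 K} (hx₀ : x₀ ∈ 𝔞) {k : Fin 2 → ℤ}
    (hk : ((b.equivFun.symm k : 𝔟) : 𝓞 K) = (Ideal.absNorm 𝔪 : 𝓞 K) * x₀) {τ : ℂ} (hτ : 0 < τ.im) :
    HasSum (fun m : Fin 2 → ℤ =>
        2 * π * I * σ ((x₀ : K) + (((b.equivFun.symm m : 𝔟) : 𝓞 K) : K)) *
          cexp (2 * π * I * τ) ^
            (Ideal.absNorm (Ideal.span {x₀ + ((b.equivFun.symm m : 𝔟) : 𝓞 K)}) / Ideal.absNorm 𝔞))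
      (fderiv ℂ (riemannThetaChar (fun i => (k i : ℂ) / (Ideal.absNorm 𝔪 : ℕ)) 0
          ((((Ideal.absNorm 𝔪 : ℕ) : ℂ) * τ) • B.map ((↑) : ℤ → ℂ))) 0
        fun i => σ ((b i : 𝓞 K) : K)) := by
  have hM : Ideal.absNorm 𝔪 ≠ 0 := by rw [Ne, Ideal.absNorm_eq_zero_iff]; exact h𝔪
  have hτ' : 0 < ((((Ideal.absNorm 𝔪 : ℕ) : ℂ) * τ)).im := by
    rw [Complex.mul_im, Complex.natCast_re, Complex.natCast_im, zero_mul, add_zero]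
    exact mul_pos (by exact_mod_cast Nat.pos_of_ne_zero hM) hτ
  have hZ := smul_mem_siegelUpperHalfSpace hsymm hpos hτ'
  obtain ⟨c, hc, hY⟩ := exists_pos_mul_sum_sq_le_of_posDef_im _ hZ.2
  have hZs : ∀ i j, (((((Ideal.absNorm 𝔪 : ℕ) : ℂ) * τ)) • B.map ((↑) : ℤ → ℂ)) i j =
      (((((Ideal.absNorm 𝔪 : ℕ) : ℂ) * τ)) • B.map ((↑) : ℤ → ℂ)) j i :=
    fun i j => (hZ.1.apply i j).symm
  have h := hasSum_fderiv_riemannThetaChar_apply _ hZs hc hY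
    (fun i => (k i : ℂ) / (Ideal.absNorm 𝔪 : ℕ)) 0 0 (fun i => σ ((b i : 𝓞 K) : K))
  refine h.congr_fun fun m => ?_
  rw [riemannThetaCharTerm_coset_eq_pow hK σ h𝔟 h𝔞 h𝔪 b hB hx₀ hk τ m,
    dotProduct_coset_eq_embedding σ b hM hk m]


/-! ### Dependence on the coset only -/

omit [NumberField K] in
/-- **`Θ(τ; x₀ + 𝔟)` depends only on the coset**: if `x₀' - x₀ ∈ 𝔟` then the characteristics
`k'/M` and `k/M` differ by an integer vector, and `ϑ[k'/M; 0] = ϑ[k/M; 0]`. -/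
theorem riemannThetaChar_coset_eq_of_sub_mem {𝔟 : Ideal (𝓞 K)} (b : Basis (Fin 2) ℤ 𝔟) {M : ℕ}
    (hM : M ≠ 0) {x₀ x₀' : 𝓞 K} {k k' : Fin 2 → ℤ}
    (hk : ((b.equivFun.symm k : 𝔟) : 𝓞 K) = (M : 𝓞 K) * x₀)
    (hk' : ((b.equivFun.symm k' : 𝔟) : 𝓞 K) = (M : 𝓞 K) * x₀') (hy : x₀' - x₀ ∈ 𝔟)
    (Ω : Matrix (Fin 2) (Fin 2) ℂ) (z : Fin 2 → ℂ) :
    riemannThetaChar (fun i => (k' i : ℂ) / M) 0 Ω z = riemannThetaChar (fun i => (k i : ℂ) / M) 0 Ω z := by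
  have hM' : (M : ℂ) ≠ 0 := by exact_mod_cast hM
  set w : Fin 2 → ℤ := b.equivFun ⟨x₀' - x₀, hy⟩ with hw
  have hkw : k' = fun i => (M : ℤ) * w i + k i := by
    apply b.equivFun.symm.injective
    apply Subtype.ext
    rw [coe_equivFun_symm_natCast_mul_add, hk, hk', hw, LinearEquiv.symm_apply_apply]
    push_cast
    ring
  have hchar : (fun i => (k' i : ℂ) / M) = (fun i => (k i : ℂ) / M) + fun i => (w i : ℂ) := by
    funext i
    simp only [hkw, Pi.add_apply]
    push_cast
    field_simp
    ring
  rw [hchar, riemannThetaChar_charShift_fst]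

/-! ### The law on `Γ₀(|d_K|·M)` -/

/-- **The weight-two law of the coset theta of an ideal class.**  `K` imaginary quadratic with
Kronecker character `κ` (primitive, odd, `κ² = 1`, `ζ_K = ζ·L(κ)`), `𝔟 = 𝔞𝔪` with Gram data
`(b, B)` (`det B = |d_K|`), `M = N𝔪`, `x₀ ∈ 𝔞` with coordinates `k` of `M x₀`, `u = (σ bᵢ)ᵢ`.  For
`γ = (a b; c d) ∈ SL₂(ℤ)` with `|d_K|·M ∣ c`:
`∇_u ϑ[d·k/M; 0](0, (M·γτ)·B) = κ(d) (cτ+d)² ∇_u ϑ[k/M; 0](0, (Mτ)·B)`, i.e.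
`Θ(γτ; d x₀ + 𝔟) = κ(d)(cτ+d)² Θ(τ; x₀ + 𝔟)`. -/
theorem fderiv_thetaCoset_apply_moeb (hK : finrank ℚ K = 2) [IsTotallyComplex K] (σ : K →+* ℂ)
    {κ : DirichletCharacter ℂ (discr K).natAbs} (hprim : κ.IsPrimitive) (hodd : κ.Odd)
    (hquad : κ ^ 2 = 1)
    (hζ : ∀ s : ℂ, 1 < s.re → NumberField.dedekindZeta K s = riemannZeta s * LSeries (fun n => κ n) s)
    {𝔞 𝔪 𝔟 : Ideal (𝓞 K)} (h𝔟 : 𝔟 = 𝔞 * 𝔪) (h𝔞 : 𝔞 ≠ ⊥) (h𝔪 : 𝔪 ≠ ⊥) (b : Basis (Fin 2) ℤ 𝔟)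
    {B : Matrix (Fin 2) (Fin 2) ℤ}
    (hB : ∀ i j, ((B i j : ℤ) : ℂ) * ((Ideal.absNorm 𝔟 : ℕ) : ℂ) =
      σ ((b i : 𝓞 K) : K) * conj (σ ((b j : 𝓞 K) : K)) + conj (σ ((b i : 𝓞 K) : K)) * σ ((b j : 𝓞 K) : K))
    (hsymm : B.IsSymm) (h00 : Even (B 0 0)) (h11 : Even (B 1 1))
    (hdet : B.det = ((discr K).natAbs : ℤ)) (hpos : (B.map (Int.cast : ℤ → ℝ)).PosDef)
    {x₀ : 𝓞 K} (hx₀ : x₀ ∈ 𝔞) {k : Fin 2 → ℤ}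
    (hk : ((b.equivFun.symm k : 𝔟) : 𝓞 K) = (Ideal.absNorm 𝔪 : 𝓞 K) * x₀)
    {γ : SL(2, ℤ)} (hγ : (((discr K).natAbs * Ideal.absNorm 𝔪 : ℕ) : ℤ) ∣ (γ 1 0 : ℤ)) (τ : ℍ) :
    fderiv ℂ (riemannThetaChar (fun i => ((γ 1 1 : ℤ) : ℂ) * ((k i : ℂ) / (Ideal.absNorm 𝔪 : ℕ))) 0
        ((((Ideal.absNorm 𝔪 : ℕ) : ℂ) * ((γ • τ : ℍ) : ℂ)) • B.map ((↑) : ℤ → ℂ))) 0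
        (fun i => σ ((b i : 𝓞 K) : K)) =
      κ ((γ 1 1 : ℤ) : ZMod (discr K).natAbs) * (((γ 1 0 : ℤ) : ℂ) * (τ : ℂ) + ((γ 1 1 : ℤ) : ℂ)) ^ 2 *
        fderiv ℂ (riemannThetaChar (fun i => (k i : ℂ) / (Ideal.absNorm 𝔪 : ℕ)) 0
          ((((Ideal.absNorm 𝔪 : ℕ) : ℂ) * (τ : ℂ)) • B.map ((↑) : ℤ → ℂ))) 0
          (fun i => σ ((b i : 𝓞 K) : K)) := by
  set M : ℕ := Ideal.absNorm 𝔪 with hMdef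
  have hM : M ≠ 0 := by rw [hMdef, Ne, Ideal.absNorm_eq_zero_iff]; exact h𝔪
  have hMpos : 0 < M := Nat.pos_of_ne_zero hM
  have h𝔟0 : 𝔟 ≠ ⊥ := by rw [h𝔟]; exact mul_ne_zero h𝔞 h𝔪
  haveI : NeZero (discr K).natAbs := ⟨Int.natAbs_ne_zero.mpr (NumberField.discr_ne_zero K)⟩
  -- the lift `γ'`
  have hMc : (M : ℤ) ∣ (γ 1 0 : ℤ) :=
    dvd_trans ⟨((discr K).natAbs : ℤ), by push_cast; ring⟩ hγ
  obtain ⟨γ', h00', h01', h10', h11'⟩ := exists_levelLift M γ hMc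
  have hγ'D : ((discr K).natAbs : ℤ) ∣ (γ' 1 0 : ℤ) := by
    have h : ((discr K).natAbs : ℤ) * (M : ℤ) ∣ (γ' 1 0 : ℤ) * (M : ℤ) := by
      rw [h10']; exact_mod_cast hγ
    exact Int.dvd_of_mul_dvd_mul_right (by exact_mod_cast hM) h
  have hγ'B : B.det ∣ (γ' 1 0 : ℤ) := by rw [hdet]; exact hγ'D
  -- the unit of the genus-two law, pinned by the Kronecker character
  obtain ⟨Λ, _, hfull, hnull⟩ :=
    exists_unit_riemannThetaChar_zero_transform hsymm h00 h11 hpos hγ'B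
  have hΛκ : Λ = κ ((γ' 1 1 : ℤ) : ZMod (discr K).natAbs) :=
    binaryTheta_unit_eq_kronecker hK σ (D := (discr K).natAbs) (dvd_refl _) hprim hodd hquad hζ
      h𝔟0 b hB hsymm hpos (γ := γ') hγ'D
      (fun τ => by rw [coe_sl_smul]; exact riemannThetaChar_zero_smul_transform hnull τ.im_pos)
  -- the matrix-level law, applied to `u`
  have hmat := fderiv_thetaCoset_smul hsymm h00 h11 hpos hMpos h00' h01' h10' h11' hγ'B hfull k τ
  have hu := congrArg (fun L : (Fin 2 → ℂ) →L[ℂ] ℂ => L (fun i => σ ((b i : 𝓞 K) : K))) hmat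
  simp only [FunLike.coe_smul, Pi.smul_apply, smul_eq_mul] at hu
  rw [hu, hΛκ, h11']
  -- the phase is trivial
  have hph : cexp (π * I * (((γ 0 1 : ℤ) : ℂ) * ((γ 1 1 : ℤ) : ℂ) * ((k ⬝ᵥ (B *ᵥ k) : ℤ) : ℂ) / M)) = 1 := by
    obtain ⟨n, hn⟩ : ∃ n : ℕ, n = Ideal.absNorm (Ideal.span {x₀}) / Ideal.absNorm 𝔞 := ⟨_, rfl⟩
    rw [dotProduct_mulVec_coords hK σ h𝔟 h𝔞 h𝔪 b hB hx₀ hk, ← hn]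
    have hM' : (M : ℂ) ≠ 0 := by exact_mod_cast hM
    have hcast : (((2 * (Ideal.absNorm 𝔪 : ℤ) * (n : ℤ) : ℤ)) : ℂ) = 2 * (M : ℂ) * (n : ℂ) := by
      rw [hMdef]; push_cast; ring
    rw [hcast, show π * I * (((γ 0 1 : ℤ) : ℂ) * ((γ 1 1 : ℤ) : ℂ) * (2 * (M : ℂ) * (n : ℂ)) / M) =
        (((γ 0 1 : ℤ) * (γ 1 1 : ℤ) * (n : ℤ) : ℤ) : ℂ) * (2 * π * I) by push_cast; field_simp]
    exact Complex.exp_int_mul_two_pi_mul_I _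
  rw [hph, mul_one]

end Summit.BirchSwinnertonDyer.BirchSwinnertonDyer.Theorems.HeckeTheta

end
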